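/-
Copyright (c) 2026 the pub-hodgecm-mathlib formalisation cell (harness21).  Prover seat hodgecm-mathlib-LH4-p13 (g9), req620 Track A «(D-RAM) FOUR-FRAME» squad
((β₂) road (R-36); β₂ sub-dealer LH4-p04 (g9) β₂ WORD #12: socket (U-mid) «upper line, middle band» of LH4-p12 (g8)'s (OFF) assembly ED. 2; helper lane on
h413 = stmt-HodgeConjecture-24833, count-neutral), 2026-09-04.
-/
import Summits.HodgeConjecture.HodgeConjecture.Theorems.F0P3cDyRamTopConeCellEmpty            -- ★ (this seat): `levelSetDep_inter_shell_eq_empty_of_top` (the fold); brings ★ p862869 junction, ★ p862855 `not_latticeInLevel_sq_endoGL_sub_one_of_top`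
import Summits.HodgeConjecture.HodgeConjecture.Theorems.F0P3cDyRamCleanLevelOfKernelCHBlock   -- ★ p861941 (LH4-p04 (g8)): (α′)₂ `latticeInLevel_sq_endoGL_of_shell_of_valueSet_eq_of_formCongr`
import Literature.NumberTheory.Automorphic.UnitaryLatticeTreeStabilizer                         -- ★ `mapGL_latt_le_latt_iff`, `mapGL_latt_eq_latt_iff` (the stabiliser test)
import Literature.NumberTheory.Automorphic.UnitaryLatticeTreeTypeTwoHyperbolic                  -- ★ `eq_one_of_mul_self_eq_one` (in `ℤᵐ⁰`)
import HarnessLib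

/-!
# Crux `H413`, line LH4 «(D-RAM) FOUR-FRAME» — the (β₂) road (R-36), β₂-BOARD v2 §1 ED. 2 «OFF-ROW ZERO», socket (U-mid) of LH4-p12 (g8)'s (OFF) assembly ED. 2:
# «A MIDDLE-BAND TOP CONE CELL CONTRIBUTES ZERO» — `m* ≤ 2(m − b) < m_c` on the upper line: the `−′` subset is empty by the square digit at `m_c` (★ p862855), the `+`
# subset is empty because a `+` label on the `(ℓ₀, m*)`-shell forces the square token at `m_c` ((α′)₂, ★ p861941) — which the same digit denies

Cell `hodgecm-mathlib` (D-0151), FLOOR 0, crux item H413 = `stmt-HodgeConjecture-24833`, route of record `HCCMUnconditional`; squad F0∕P3c∕LH4; lane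
`--supports stmt-HodgeConjecture-24833 --as helper` (count-neutral; pays NO tier-0 row).  THEOREMS ONLY (no `def`, no instance, no notation, no `sorry`, default heartbeats);
★-only imports; states NO law; (β₂) stays a HYPOTHESIS.  DATUM-FREE: ★ p861044∕p861305's block frame in ★ p861305 §3's GENERAL-BLOCK spelling `(H₂, h_W, P₁, γ₂, φ, h, f)`
(so one theorem serves both literals of `beta2ConesB.letter.v2`), the line model of ★ (C1), the ramified datum `hD` on `E`, ★ DEFS `levelSetDep`.

WHY (β₂ sub-dealer LH4-p04 (g9) WORD #12, 23:04:13Z; LH4-p12 (g8)'s ED. 2 `cellDiff_offRow_eq_zero_of_pieces₂`, socket `hUmid : ∀ j b, 1 ≤ b → b < j → m < 2b → j + m = jl + b →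
m* + 2b ≤ 2m → 2m < m_c + 2b → lam ∈ 𝒪_j → cellDiff(j, b) = 0`).  On the middle band the vertex CAN sit on the `(ℓ₀, m*)`-shell (the square digit of ★ p862855 only bites at
`k > 2(m − b)`), so «off-shell» is not available for the `+` label; instead:
* §1 `mapGL_eq_of_latticeInLevel` — Γ-FIXEDNESS of a vertex FROM ITS LEVEL TOKEN: `L = latt g`, `(Γ − 1)·L ⊆ ϖ^ℓ·L`, `|ϖ| ≤ 1`, `|det Γ| = 1` ⇒ `Γ·L = L` (★ stabiliser test:
  `g⁻¹Γg` is integral, hence so is its inverse by `|det| = 1`, ★ `isIntMatrix_nonsing_inv_of_v_det_eq_one`) — the cell predicate of `beta2ConesB` carries the shell, not the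
  fixedness that (α′)₂ wants; `v_det_endoGL_eq_one` reads `|det ι(γ₂, u)| = 1` off `det γ₂·σ(det γ₂) = 1`, `|u₀₀| = 1`.
* §2 HEAD `cellDiff_topMid_eq_zero` — in `OFF.letter.v1`'s one-literal currency, letters in LH4-p12's order (`j b`, `1 ≤ b`, `b < j`, `m < 2b`, `j + m = jl + b`, `m* + 2b ≤ 2m`,
  `2m < m_c + 2b`, `lam ∈ 𝒪_j`) preceded by the context letters `m_c ≤ m` (fence) and the unitary frame `P₁ hA hΓ`, `hdet hu`, `hs hp` of the OFF block: the `−′` subset is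
  `∅` by ★ `levelSetDep_inter_shell_eq_empty_of_top` at `k = m_c` (`jl + m < j + b + m_c`); the `+` subset is `∅` since for a presented vertex (LH7-p09's junction) on the
  `(ℓ₀, m*)`-shell with `VS = V₊`, (α′)₂ ★ p861941 (type 0 = self-dual, Γ-fixed by §1, `hs hp`) gives `LatticeInLevel ϖ m_c ((Γ−1)²) L₃`, contradicting ★ p862855
  `not_latticeInLevel_sq_endoGL_sub_one_of_top` at `k = m_c`; both finsums vanish.
HONEST LABEL.  Count-neutral lattice bookkeeping; nothing printed is asserted; the LOW band `m_c ≤ 2(m − b)` (labelled, balanced) is NOT here (LH7-p09 (g2), «the two balanced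
lines»); `HC_CM` is proved only modulo the 7 printed citations (2 remaining named inputs: hLiu418 = `stmt-HodgeConjecture-24832`, h413 = `stmt-HodgeConjecture-24833`) until rung 0 closes.
## References
* [Kottwitz1986BaseChangeUnits] R. E. Kottwitz, *Base change for unit elements of Hecke algebras*, Compositio Math. 60 (1986): §1 pp. 240–241 (congruence-level pieces as lattice conditions).
* [Serre1980Trees] J.-P. Serre, *Trees*, Springer (1980): Ch. II §1.1 (the stabiliser of a lattice).
* [Jacobowitz1962] R. Jacobowitz, *Hermitian forms over local fields*, Amer. J. Math. 84 (1962): §4, §7 (unimodular lattices).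
* [Rogawski1990] J. D. Rogawski, *Automorphic Representations of Unitary Groups in Three Variables*, Ann. of Math. Stud. 123 (1990): §4.8 Case (a) p. 53; §4.9 Prop. 4.9.1 (b) p. 55.
-/

set_option autoImplicit false

noncomputable section

namespace Summit.HodgeConjecture.HodgeConjecture.Cruxes.H413.F0P3cDyRamTopConeCellMid

open scoped Valued WithZero Matrix MatrixGroups
open WithZero
open Literature.NumberTheory.Automorphic Literature.NumberTheory.Automorphic.HermitianLattice Literature.NumberTheory.Automorphic.UnitaryLatticeTree
open Literature.NumberTheory.Automorphic.UnitaryGroup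
open Literature.NumberTheory.Automorphic.UnitaryThreeFourFrame (IsRamifiedQuadraticDatum)
open Literature.NumberTheory.LocalFields.WildQuadraticDatum (d_le_succ_t)
open Literature.NumberTheory.Rogawski1990
open Summit.HodgeConjecture.HodgeConjecture.Cruxes.H413.F0P3cDyRamToricCensusDefs
open Summit.HodgeConjecture.HodgeConjecture.Cruxes.H413.F0P3cDyRamFourFramePieces
open Summit.HodgeConjecture.HodgeConjecture.Cruxes.H413.F0P3cDyRamFourFrameCensusDefs (LatticeInLevel LatticeNearTransvShell)
open Summit.HodgeConjecture.HodgeConjecture.Cruxes.H413.F0P3cDyRamStageOneBDefs (mcOfRecord mstarOfRecord_le_mcOfRecord)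
open Summit.HodgeConjecture.HodgeConjecture.Cruxes.H413.F0P3cDyRamConeCellPresentation (exists_presentation_of_mem_levelSetDep)
open Summit.HodgeConjecture.HodgeConjecture.Cruxes.H413.F0P3cDyRamTopConeCellOffShell (v_pow_eq_exp_neg' not_latticeInLevel_sq_endoGL_sub_one_of_top)
open Summit.HodgeConjecture.HodgeConjecture.Cruxes.H413.F0P3cDyRamTopConeCellEmpty (levelSetDep_inter_shell_eq_empty_of_top)
open Summit.HodgeConjecture.HodgeConjecture.Cruxes.H413.F0P3cDyRamCleanLevelOfKernelCHBlock (latticeInLevel_sq_endoGL_of_shell_of_valueSet_eq_of_formCongr)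

variable {E M : Type} [Field E] [Valued E ℤᵐ⁰] [Field M] [Valued M ℤᵐ⁰] {ρ Θ : M →+* M} {α : M}

/-! ## §1 Γ-fixedness of a vertex from its level token -/

/-- **A VERTEX IN LEVEL `ℓ` FOR `Γ` WITH `|det Γ| = 1` IS Γ-FIXED**: for `L = latt g`, `(Γ − 1)·L ⊆ ϖ^ℓ·L` with `|ϖ| ≤ 1` gives `Γ·L ⊆ L`, i.e. `g⁻¹Γg` integral (★ stabiliser test);
its determinant is a unit, so its inverse is integral too (★ `isIntMatrix_nonsing_inv_of_v_det_eq_one`) and `Γ·L = L`. [cite: Serre1980Trees, Ch. II §1.1] [cite: Kottwitz1986BaseChangeUnits, §1 pp. 240–241] -/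
theorem mapGL_eq_of_latticeInLevel {ϖ : E} (hϖ1 : Valued.v ϖ ≤ 1) {Γ : GL (Fin 3) E} (hdet : Valued.v (Γ : Matrix (Fin 3) (Fin 3) E).det = 1)
    (g : GL (Fin 3) E) (ℓ : ℕ) (hlev : LatticeInLevel ϖ ℓ ((Γ : Matrix (Fin 3) (Fin 3) E) - 1) (latt (g : Matrix (Fin 3) (Fin 3) E))) :
    mapGL Γ (latt (g : Matrix (Fin 3) (Fin 3) E)) = latt (g : Matrix (Fin 3) (Fin 3) E) := by
  -- `Γ·L ⊆ L`
  have hle : mapGL Γ (latt (g : Matrix (Fin 3) (Fin 3) E)) ≤ latt (g : Matrix (Fin 3) (Fin 3) E) := by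
    rintro _ ⟨y, hy, rfl⟩
    have hXy : ((Γ : Matrix (Fin 3) (Fin 3) E) - 1) *ᵥ y ∈ latt (g : Matrix (Fin 3) (Fin 3) E) := by
      have h1 : ((Γ : Matrix (Fin 3) (Fin 3) E) - 1) *ᵥ y ∈ scaleLattice (ϖ ^ ℓ) (latt (g : Matrix (Fin 3) (Fin 3) E)) :=
        hlev ⟨y, hy, rfl⟩
      exact scaleLattice_le_self_of_v_le_one (by rw [map_pow]; exact pow_le_one₀ zero_le hϖ1) _ h1
    have e : (Γ : Matrix (Fin 3) (Fin 3) E) *ᵥ y = ((Γ : Matrix (Fin 3) (Fin 3) E) - 1) *ᵥ y + y := by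
      rw [Matrix.sub_mulVec, Matrix.one_mulVec, sub_add_cancel]
    show (Matrix.toLin' (Γ : Matrix (Fin 3) (Fin 3) E)) y ∈ latt (g : Matrix (Fin 3) (Fin 3) E)
    rw [Matrix.toLin'_apply, e]
    exact add_mem hXy hy
  rw [mapGL_latt_le_latt_iff] at hle
  -- the conjugate has unit determinant, so its inverse is integral
  have hdet' : Valued.v (((g⁻¹ * Γ * g : GL (Fin 3) E)) : Matrix (Fin 3) (Fin 3) E).det = 1 := by
    rw [Units.val_mul, Units.val_mul, Matrix.det_mul, Matrix.det_mul, map_mul, map_mul, hdet, mul_one, ← map_mul, ← Matrix.det_mul,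
      coe_inv_eq_nonsing_inv, Matrix.nonsing_inv_mul _ (isUnit_det_coe g), Matrix.det_one, map_one]
  have hinv : IsIntMatrix (((g⁻¹ * Γ⁻¹ * g : GL (Fin 3) E)) : Matrix (Fin 3) (Fin 3) E) := by
    have h := isIntMatrix_nonsing_inv_of_v_det_eq_one hle hdet'
    have e : ((g⁻¹ * Γ⁻¹ * g : GL (Fin 3) E)) = (g⁻¹ * Γ * g)⁻¹ := by group
    rwa [e, coe_inv_eq_nonsing_inv]
  exact (mapGL_latt_eq_latt_iff Γ g).2 ⟨hle, hinv⟩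

/-- **`|det ι(γ₂, u)| = 1`** from `det γ₂·σ(det γ₂) = 1` (`σ` isometric) and `|u₀₀| = 1`. [cite: Rogawski1990, §4.8 Case (a) p. 53] -/
theorem v_det_endoGL_eq_one {σ : E →+* E} (hvσ : ∀ a, Valued.v (σ a) = Valued.v a) (γ₂ : GL (Fin 2) E) (u : GL (Fin 1) E)
    (hdet : (γ₂ : Matrix (Fin 2) (Fin 2) E).det * σ (γ₂ : Matrix (Fin 2) (Fin 2) E).det = 1) (hu : Valued.v ((u : Matrix (Fin 1) (Fin 1) E) 0 0) = 1) :
    Valued.v (((endoGL (γ₂, u) : GL (Fin 3) E) : Matrix (Fin 3) (Fin 3) E)).det = 1 := by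
  have h2 : Valued.v (γ₂ : Matrix (Fin 2) (Fin 2) E).det = 1 := by
    have h := congrArg Valued.v hdet
    rw [map_mul, hvσ, map_one] at h
    exact eq_one_of_mul_self_eq_one h
  rw [coe_endoGL_eq_endoShape, det_endoShape, map_mul, h2, hu, one_mul]

/-! ## §2 HEAD — the middle band of socket (U) at the cell, in `OFF.letter.v1`'s one-literal currency -/

/-- **«A TOP-DIAGONAL CONE CELL BELOW THE `m_c`-DIGIT CONTRIBUTES ZERO» — GENERAL HEAD** (covers the HIGH and MIDDLE bands AND the diagonal cell `j = b`; minimal letters after the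
context letters `hmcm`, `P₁ hA hΓ`, `hdet hu`, `hs hp`): `1 ≤ b`, `j + m = jl + b`, `2m < m_c + 2b`, `lam ∈ 𝒪_j` ⟹ `cellDiff(j, b) = 0` (no `b < j`, no `m < 2b`, no lower band edge).  The `−′` subset is `∅` (square digit at `k = m_c`,
★ `levelSetDep_inter_shell_eq_empty_of_top`); the `+` subset is `∅` since a presented vertex (★ junction) on the `(ℓ₀, m*)`-shell with `VS = V₊` is Γ-fixed (§1) and self-dual, so
(α′)₂ ★ p861941 puts `(Γ − 1)²` in level `m_c` on it — against ★ p862855 at `k = m_c`. [cite: Kottwitz1986BaseChangeUnits, §1 pp. 240–241] [cite: Rogawski1990, §4.9 Prop. 4.9.1 (b) p. 55]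
[cite: Jacobowitz1962, §4, §7] -/
theorem cellDiff_top_eq_zero
    (σ : E →+* E) {ϖ : E} {d tE : ℕ} (hD : IsRamifiedQuadraticDatum σ ϖ d tE)
    {H₂ : Matrix (Fin 2) (Fin 2) E} (hH₂ : IsUnit H₂.det) (hH₂σ : (H₂.map σ)ᵀ = H₂) {hW : E} (hhW : Valued.v hW = 1)
    (jE : E →+* M) (hρρ : ∀ x, ρ (ρ x) = x) (hvρ : ∀ x, Valued.v (ρ x) = Valued.v x) (hα : ρ α ≠ α) (hα1 : Valued.v α ≤ 1)
    (hint : ∀ z : M, Valued.v z ≤ 1 → Valued.v ((z - ρ z) / (α - ρ α)) ≤ 1)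
    (hΘΘ : ∀ x, Θ (Θ x) = x) (hΘρ : ∀ x, Θ (ρ x) = ρ (Θ x)) (hvΘ : ∀ x, Valued.v (Θ x) = Valued.v x)
    (hjv : ∀ c, Valued.v (jE c) ≤ 1 ↔ Valued.v c ≤ 1) (hjfix : ∀ z, ρ z = z ↔ ∃ c, jE c = z)
    (hjpow : ∀ (t : E) (n : ℤ), Valued.v (jE t) = Valued.v (jE ϖ) ^ n ↔ Valued.v t = Valued.v ϖ ^ n)
    (hϖmax : ∀ t : M, ρ t = t → Valued.v t < 1 → Valued.v t ≤ Valued.v (jE ϖ)) (hjiso : ∀ a, Valued.v (jE a) = Valued.v a)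
    (hU : Valued.v (α - ρ α) = 1)
    (φ : (Fin 2 → E) →+ M) (hφs : ∀ (c : E) (x : Fin 2 → E), φ (c • x) = jE c * φ x) (hφi : Function.Injective φ) (hφo : Function.Surjective φ)
    {γ₂ : GL (Fin 2) E} {lam h : M} (hφγ : ∀ x, φ ((γ₂ : Matrix (Fin 2) (Fin 2) E).mulVec x) = lam * φ x) (hlam : Valued.v lam = 1)
    (hΘh : Θ h = h) (hh : h ≠ 0) (hform : ∀ x y, jE (pairing σ H₂ x y) = h * Θ (φ x) * φ y + ρ (h * Θ (φ x) * φ y))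
    (u : GL (Fin 1) E) (hum : Valued.v (((u : Matrix (Fin 1) (Fin 1) E) 0 0) - 1) ≤ Valued.v (ϖ ^ mstarOfRecord d))
    {m jl : ℕ} (hm : Valued.v (lam - jE ((u : Matrix (Fin 1) (Fin 1) E) 0 0)) = WithZero.exp (-(m : ℤ)))
    (hjl : Valued.v ((lam - jE ((u : Matrix (Fin 1) (Fin 1) E) 0 0)) - ρ (lam - jE ((u : Matrix (Fin 1) (Fin 1) E) 0 0))) = WithZero.exp (-(jl : ℤ)))
    (f : ℕ → ℕ → AddSubgroup M → ℕ) (hmcm : mcOfRecord d ≤ m)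
    (P₁ : GL (Fin 3) E) (hA : formCongr σ P₁ ((StdForm.antidiagonal 3).over E) = (!![H₂ 0 0, 0, H₂ 0 1; 0, hW, 0; H₂ 1 0, 0, H₂ 1 1] : Matrix (Fin 3) (Fin 3) E))
    (hΓ : P₁ * endoGL (γ₂, u) * P₁⁻¹ ∈ unitaryGroupOfForm σ ((StdForm.antidiagonal 3).over E))
    (hdet : (γ₂ : Matrix (Fin 2) (Fin 2) E).det * σ (γ₂ : Matrix (Fin 2) (Fin 2) E).det = 1) (hu : Valued.v ((u : Matrix (Fin 1) (Fin 1) E) 0 0) = 1)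
    (hs : Valued.v ((γ₂ : Matrix (Fin 2) (Fin 2) E).trace - 2) * Valued.v (ϖ ^ (d % 2)) ≤ Valued.v (ϖ ^ mcOfRecord d))
    (hp : Valued.v ((γ₂ : Matrix (Fin 2) (Fin 2) E).det - (γ₂ : Matrix (Fin 2) (Fin 2) E).trace + 1) ≤ Valued.v (ϖ ^ mcOfRecord d))
    (j b : ℕ) (hb1 : 1 ≤ b) (hline : j + m = jl + b) (hband2 : 2 * m < mcOfRecord d + 2 * b) (hlamj : IsOrd ρ α (jE ϖ ^ j) lam) :
    ((∑ᶠ Λ ∈ levelSetDep ρ Θ α (jE ϖ) h j b (lam - jE ((u : Matrix (Fin 1) (Fin 1) E) 0 0)) ∩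
                      {Λ | ∃ B : Submodule 𝒪[E] (Fin 2 → E), B.toAddSubgroup.map φ = Λ ∧
                        ∃ L₃ : Submodule 𝒪[E] (Fin 3 → E), IsSelfDualLattice σ ϖ (!![H₂ 0 0, 0, H₂ 0 1; 0, hW, 0; H₂ 1 0, 0, H₂ 1 1] : Matrix (Fin 3) (Fin 3) E) L₃ ∧
                          L₃ ⊓ LinearMap.ker ((LinearMap.proj (1 : Fin 3) : (Fin 3 → E) →ₗ[E] E).restrictScalars 𝒪[E]) =
                            B.map ((Matrix.toLin' (!![1, 0; 0, 0; 0, 1] : Matrix (Fin 3) (Fin 2) E)).restrictScalars 𝒪[E]) ∧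
                          (∀ c : E, (Pi.single 1 c : Fin 3 → E) ∈ L₃ ↔ Valued.v c ≤ Valued.v ϖ ^ b) ∧
                          (LatticeNearTransvShell ϖ (d % 2) (mstarOfRecord d) ((((endoGL (γ₂, u) : GL (Fin 3) E) : Matrix (Fin 3) (Fin 3) E) - 1)) L₃ ∧
                            {z : E | ∃ y ∈ L₃, Valued.v ((ϖ ^ (mstarOfRecord d))⁻¹ * (z - pairing σ (!![H₂ 0 0, 0, H₂ 0 1; 0, hW, 0; H₂ 1 0, 0, H₂ 1 1] : Matrix (Fin 3) (Fin 3) E) y (((((endoGL (γ₂, u) : GL (Fin 3) E) : Matrix (Fin 3) (Fin 3) E) - 1)) *ᵥ y))) ≤ 1} =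
                              valueSetMod σ ϖ (mstarOfRecord d) (xPlus σ ϖ d))}, f b j Λ : ℕ) : ℤ) -
      ((∑ᶠ Λ ∈ levelSetDep ρ Θ α (jE ϖ) h j b (lam - jE ((u : Matrix (Fin 1) (Fin 1) E) 0 0)) ∩
                      {Λ | ∃ B : Submodule 𝒪[E] (Fin 2 → E), B.toAddSubgroup.map φ = Λ ∧
                        ∃ L₃ : Submodule 𝒪[E] (Fin 3 → E), IsSelfDualLattice σ ϖ (!![H₂ 0 0, 0, H₂ 0 1; 0, hW, 0; H₂ 1 0, 0, H₂ 1 1] : Matrix (Fin 3) (Fin 3) E) L₃ ∧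
                          L₃ ⊓ LinearMap.ker ((LinearMap.proj (1 : Fin 3) : (Fin 3 → E) →ₗ[E] E).restrictScalars 𝒪[E]) =
                            B.map ((Matrix.toLin' (!![1, 0; 0, 0; 0, 1] : Matrix (Fin 3) (Fin 2) E)).restrictScalars 𝒪[E]) ∧
                          (∀ c : E, (Pi.single 1 c : Fin 3 → E) ∈ L₃ ↔ Valued.v c ≤ Valued.v ϖ ^ b) ∧
                          (LatticeNearTransvShell ϖ (d % 2) (mcOfRecord d) ((((endoGL (γ₂, u) : GL (Fin 3) E) : Matrix (Fin 3) (Fin 3) E) - 1)) L₃ ∧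
                            ¬ {z : E | ∃ y ∈ L₃, Valued.v ((ϖ ^ (mstarOfRecord d))⁻¹ * (z - pairing σ (!![H₂ 0 0, 0, H₂ 0 1; 0, hW, 0; H₂ 1 0, 0, H₂ 1 1] : Matrix (Fin 3) (Fin 3) E) y (((((endoGL (γ₂, u) : GL (Fin 3) E) : Matrix (Fin 3) (Fin 3) E) - 1)) *ᵥ y))) ≤ 1} =
                              valueSetMod σ ϖ (mstarOfRecord d) (xPlus σ ϖ d))}, f b j Λ : ℕ) : ℤ) = 0 := by
  obtain ⟨hσ, hvσ, hϖ, hfix, hdd, h1d, ht⟩ := id hD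
  have hvϖ0 : Valued.v ϖ ≠ 0 := by rw [hϖ]; exact exp_ne_zero
  have hϖle : Valued.v ϖ ≤ 1 := by rw [hϖ, ← exp_zero, exp_le_exp]; norm_num
  have hjϖ : Valued.v (jE ϖ) = exp (-1 : ℤ) := by rw [hjiso, hϖ]
  have hjϖ0 : jE ϖ ≠ 0 := fun h0 => by rw [h0, map_zero] at hjϖ; exact (exp_ne_zero hjϖ.symm).elim
  have hjϖle : Valued.v (jE ϖ) ≤ 1 := by rw [hjiso]; exact hϖle
  have hPn : ∀ n : ℕ, Valued.v (jE ϖ) ^ n = exp (-(n : ℤ)) := v_pow_eq_exp_neg' hjϖ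
  -- the key letters in `|ϖE|^·`-currency
  have hm' : Valued.v (lam - jE ((u : Matrix (Fin 1) (Fin 1) E) 0 0)) = Valued.v (jE ϖ) ^ m := by rw [hPn]; exact hm
  have hjl' : Valued.v ((lam - jE ((u : Matrix (Fin 1) (Fin 1) E) 0 0)) - ρ (lam - jE ((u : Matrix (Fin 1) (Fin 1) E) 0 0))) =
      Valued.v (jE ϖ) ^ jl * Valued.v (α - ρ α) := by rw [hU, mul_one, hPn]; exact hjl
  -- arithmetic of record
  have hdt : d ≤ tE + 1 := d_le_succ_t hσ hfix hϖ hdd ht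
  have harith : mcOfRecord d ≤ mstarOfRecord d + tE := by unfold mcOfRecord mstarOfRecord; omega
  -- the smallness `|ν| ≤ |ϖE|^(m_c)`
  have hν : Valued.v ((lam - 1) + (jE ((u : Matrix (Fin 1) (Fin 1) E) 0 0) - 1)) ≤ Valued.v (jE ϖ) ^ mcOfRecord d := by
    have e : (lam - 1) + (jE ((u : Matrix (Fin 1) (Fin 1) E) 0 0) - 1) =
        (lam - jE ((u : Matrix (Fin 1) (Fin 1) E) 0 0)) + jE (2 * (((u : Matrix (Fin 1) (Fin 1) E) 0 0) - 1)) := by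
      rw [map_mul, map_sub, map_one, map_ofNat]; ring
    rw [e]
    refine (Valuation.map_add _ _ _).trans (max_le ?_ ?_)
    · rw [hm']; exact pow_le_pow_right_of_le_one' hjϖle hmcm
    · have hum' : Valued.v (((u : Matrix (Fin 1) (Fin 1) E) 0 0) - 1) ≤ Valued.v ϖ ^ mstarOfRecord d := by
        have h0 := hum
        rwa [map_pow] at h0
      have h2u : Valued.v (jE (2 * (((u : Matrix (Fin 1) (Fin 1) E) 0 0) - 1))) ≤ Valued.v (jE ϖ) ^ (tE + mstarOfRecord d) := by
        rw [hjiso, map_mul, ht, hjiso, pow_add]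
        exact mul_le_mul' le_rfl hum'
      exact h2u.trans (pow_le_pow_right_of_le_one' hjϖle (by omega))
  -- the order parameter `cc = ϖE^j`
  have hc : ρ (jE ϖ ^ j) = jE ϖ ^ j := by rw [← map_pow]; exact (hjfix _).2 ⟨ϖ ^ j, rfl⟩
  have hc0 : jE ϖ ^ j ≠ 0 := pow_ne_zero j hjϖ0
  have hc1 : Valued.v (jE ϖ ^ j) ≤ 1 := by rw [map_pow, hjiso]; exact pow_le_one₀ zero_le hϖle
  -- the `+` subset is empty: (α′)₂ against the square digit at `k = m_c`
  have hplus : levelSetDep ρ Θ α (jE ϖ) h j b (lam - jE ((u : Matrix (Fin 1) (Fin 1) E) 0 0)) ∩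
                      {Λ | ∃ B : Submodule 𝒪[E] (Fin 2 → E), B.toAddSubgroup.map φ = Λ ∧
                        ∃ L₃ : Submodule 𝒪[E] (Fin 3 → E), IsSelfDualLattice σ ϖ (!![H₂ 0 0, 0, H₂ 0 1; 0, hW, 0; H₂ 1 0, 0, H₂ 1 1] : Matrix (Fin 3) (Fin 3) E) L₃ ∧
                          L₃ ⊓ LinearMap.ker ((LinearMap.proj (1 : Fin 3) : (Fin 3 → E) →ₗ[E] E).restrictScalars 𝒪[E]) =
                            B.map ((Matrix.toLin' (!![1, 0; 0, 0; 0, 1] : Matrix (Fin 3) (Fin 2) E)).restrictScalars 𝒪[E]) ∧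
                          (∀ c : E, (Pi.single 1 c : Fin 3 → E) ∈ L₃ ↔ Valued.v c ≤ Valued.v ϖ ^ b) ∧
                          (LatticeNearTransvShell ϖ (d % 2) (mstarOfRecord d) ((((endoGL (γ₂, u) : GL (Fin 3) E) : Matrix (Fin 3) (Fin 3) E) - 1)) L₃ ∧
                            {z : E | ∃ y ∈ L₃, Valued.v ((ϖ ^ (mstarOfRecord d))⁻¹ * (z - pairing σ (!![H₂ 0 0, 0, H₂ 0 1; 0, hW, 0; H₂ 1 0, 0, H₂ 1 1] : Matrix (Fin 3) (Fin 3) E) y (((((endoGL (γ₂, u) : GL (Fin 3) E) : Matrix (Fin 3) (Fin 3) E) - 1)) *ᵥ y))) ≤ 1} =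
                              valueSetMod σ ϖ (mstarOfRecord d) (xPlus σ ϖ d))} = ∅ := by
    refine Set.subset_empty_iff.1 fun Λ hΛ => ?_
    obtain ⟨hΛ, B, hBΛ, L₃, hL, hLB, htube, hshell, hlab⟩ := hΛ
    obtain ⟨x₀, w₀, g₀, hx₀, hΛx, -, -, hylev, hw₀Y, hpr, hg₀, hg₀1, hprg⟩ :=
      exists_presentation_of_mem_levelSetDep σ hσ hvσ hϖ hH₂ hH₂σ hhW jE hρρ hvρ hα hα1 hint hΘΘ hΘρ hvΘ hjv hjfix hjpow hϖmax φ hφs hφi hφo hφγ hlam hΘh hh hform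
        ((u : Matrix (Fin 1) (Fin 1) E) 0 0) hb1 hlamj hΛ hBΛ hL hLB htube
    have hz : IsOrd ρ α (jE ϖ ^ j) ((lam - jE ((u : Matrix (Fin 1) (Fin 1) E) 0 0)) / dualGen ρ Θ α (jE ϖ ^ j) h x₀) :=
      (forall_herm_mul_mem_iff_isOrd_div hρρ hvρ hα hα1 hint hΘΘ hΘρ hvΘ hc hc0 hc1 hh hx₀ hΛx _).1 ((mem_levelSetDep_iff ρ Θ α (jE ϖ) h j b _ Λ).1 hΛ).2
    -- Γ-fixedness from the level token of the shell
    obtain ⟨g, hLg, -⟩ := id hL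
    have hfixL : mapGL (endoGL (γ₂, u)) L₃ = L₃ := by
      rw [hLg]
      refine mapGL_eq_of_latticeInLevel hϖle (v_det_endoGL_eq_one hvσ γ₂ u hdet hu) g (d % 2) ?_
      rw [← hLg]; exact hshell.1
    -- (α′)₂: the `+` label on the `m*`-shell forces the square token at `m_c` … against the square digit
    have hsq := latticeInLevel_sq_endoGL_of_shell_of_valueSet_eq_of_formCongr hD P₁ hA γ₂ u hΓ hL hfixL hshell hlab hs hp
    exact not_latticeInLevel_sq_endoGL_sub_one_of_top hvρ hα hϖ jE hjiso hjfix φ hφs hφi hφγ htube hpr hLB.symm hg₀ hg₀1 hprg hBΛ hx₀ hΛx hw₀Y hylev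
      u hm' hjl' hz hν (by omega) hsq
  -- the `−′` subset is empty: the square digit at `k = m_c`
  have hminus : levelSetDep ρ Θ α (jE ϖ) h j b (lam - jE ((u : Matrix (Fin 1) (Fin 1) E) 0 0)) ∩
                      {Λ | ∃ B : Submodule 𝒪[E] (Fin 2 → E), B.toAddSubgroup.map φ = Λ ∧
                        ∃ L₃ : Submodule 𝒪[E] (Fin 3 → E), IsSelfDualLattice σ ϖ (!![H₂ 0 0, 0, H₂ 0 1; 0, hW, 0; H₂ 1 0, 0, H₂ 1 1] : Matrix (Fin 3) (Fin 3) E) L₃ ∧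
                          L₃ ⊓ LinearMap.ker ((LinearMap.proj (1 : Fin 3) : (Fin 3 → E) →ₗ[E] E).restrictScalars 𝒪[E]) =
                            B.map ((Matrix.toLin' (!![1, 0; 0, 0; 0, 1] : Matrix (Fin 3) (Fin 2) E)).restrictScalars 𝒪[E]) ∧
                          (∀ c : E, (Pi.single 1 c : Fin 3 → E) ∈ L₃ ↔ Valued.v c ≤ Valued.v ϖ ^ b) ∧
                          (LatticeNearTransvShell ϖ (d % 2) (mcOfRecord d) ((((endoGL (γ₂, u) : GL (Fin 3) E) : Matrix (Fin 3) (Fin 3) E) - 1)) L₃ ∧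
                            ¬ {z : E | ∃ y ∈ L₃, Valued.v ((ϖ ^ (mstarOfRecord d))⁻¹ * (z - pairing σ (!![H₂ 0 0, 0, H₂ 0 1; 0, hW, 0; H₂ 1 0, 0, H₂ 1 1] : Matrix (Fin 3) (Fin 3) E) y (((((endoGL (γ₂, u) : GL (Fin 3) E) : Matrix (Fin 3) (Fin 3) E) - 1)) *ᵥ y))) ≤ 1} =
                              valueSetMod σ ϖ (mstarOfRecord d) (xPlus σ ϖ d))} = ∅ :=
    levelSetDep_inter_shell_eq_empty_of_top σ hσ hvσ hϖ hH₂ hH₂σ hhW jE hρρ hvρ hα hα1 hint hΘΘ hΘρ hvΘ hjv hjfix hjpow hϖmax hjiso φ hφs hφi hφo hφγ hlam hΘh hh hform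
      u hb1 hlamj hm' hjl' hν (by omega) (d % 2) _
  rw [hplus, hminus, finsum_mem_empty]
  simp

/-- **(U-mid) «A MIDDLE-BAND TOP-DIAGONAL CONE CELL CONTRIBUTES ZERO» — LH4-p12 (g8)'s `hUmid` socket POSITIONALLY** (its letters in its order after the context letters
`hmcm`, `P₁ hA hΓ`, `hdet hu`, `hs hp`: `j b`, `1 ≤ b`, `b < j`, `m < 2b`, `j + m = jl + b`, `m* + 2b ≤ 2m`, `2m < m_c + 2b`, `lam ∈ 𝒪_j`; the three underscored ones are
unused — `cellDiff_top_eq_zero` does the work). [cite: Kottwitz1986BaseChangeUnits, §1 pp. 240–241] [cite: Rogawski1990, §4.9 Prop. 4.9.1 (b) p. 55] -/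
theorem cellDiff_topMid_eq_zero
    (σ : E →+* E) {ϖ : E} {d tE : ℕ} (hD : IsRamifiedQuadraticDatum σ ϖ d tE)
    {H₂ : Matrix (Fin 2) (Fin 2) E} (hH₂ : IsUnit H₂.det) (hH₂σ : (H₂.map σ)ᵀ = H₂) {hW : E} (hhW : Valued.v hW = 1)
    (jE : E →+* M) (hρρ : ∀ x, ρ (ρ x) = x) (hvρ : ∀ x, Valued.v (ρ x) = Valued.v x) (hα : ρ α ≠ α) (hα1 : Valued.v α ≤ 1)
    (hint : ∀ z : M, Valued.v z ≤ 1 → Valued.v ((z - ρ z) / (α - ρ α)) ≤ 1)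
    (hΘΘ : ∀ x, Θ (Θ x) = x) (hΘρ : ∀ x, Θ (ρ x) = ρ (Θ x)) (hvΘ : ∀ x, Valued.v (Θ x) = Valued.v x)
    (hjv : ∀ c, Valued.v (jE c) ≤ 1 ↔ Valued.v c ≤ 1) (hjfix : ∀ z, ρ z = z ↔ ∃ c, jE c = z)
    (hjpow : ∀ (t : E) (n : ℤ), Valued.v (jE t) = Valued.v (jE ϖ) ^ n ↔ Valued.v t = Valued.v ϖ ^ n)
    (hϖmax : ∀ t : M, ρ t = t → Valued.v t < 1 → Valued.v t ≤ Valued.v (jE ϖ)) (hjiso : ∀ a, Valued.v (jE a) = Valued.v a)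
    (hU : Valued.v (α - ρ α) = 1)
    (φ : (Fin 2 → E) →+ M) (hφs : ∀ (c : E) (x : Fin 2 → E), φ (c • x) = jE c * φ x) (hφi : Function.Injective φ) (hφo : Function.Surjective φ)
    {γ₂ : GL (Fin 2) E} {lam h : M} (hφγ : ∀ x, φ ((γ₂ : Matrix (Fin 2) (Fin 2) E).mulVec x) = lam * φ x) (hlam : Valued.v lam = 1)
    (hΘh : Θ h = h) (hh : h ≠ 0) (hform : ∀ x y, jE (pairing σ H₂ x y) = h * Θ (φ x) * φ y + ρ (h * Θ (φ x) * φ y))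
    (u : GL (Fin 1) E) (hum : Valued.v (((u : Matrix (Fin 1) (Fin 1) E) 0 0) - 1) ≤ Valued.v (ϖ ^ mstarOfRecord d))
    {m jl : ℕ} (hm : Valued.v (lam - jE ((u : Matrix (Fin 1) (Fin 1) E) 0 0)) = WithZero.exp (-(m : ℤ)))
    (hjl : Valued.v ((lam - jE ((u : Matrix (Fin 1) (Fin 1) E) 0 0)) - ρ (lam - jE ((u : Matrix (Fin 1) (Fin 1) E) 0 0))) = WithZero.exp (-(jl : ℤ)))
    (f : ℕ → ℕ → AddSubgroup M → ℕ) (hmcm : mcOfRecord d ≤ m)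
    (P₁ : GL (Fin 3) E) (hA : formCongr σ P₁ ((StdForm.antidiagonal 3).over E) = (!![H₂ 0 0, 0, H₂ 0 1; 0, hW, 0; H₂ 1 0, 0, H₂ 1 1] : Matrix (Fin 3) (Fin 3) E))
    (hΓ : P₁ * endoGL (γ₂, u) * P₁⁻¹ ∈ unitaryGroupOfForm σ ((StdForm.antidiagonal 3).over E))
    (hdet : (γ₂ : Matrix (Fin 2) (Fin 2) E).det * σ (γ₂ : Matrix (Fin 2) (Fin 2) E).det = 1) (hu : Valued.v ((u : Matrix (Fin 1) (Fin 1) E) 0 0) = 1)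
    (hs : Valued.v ((γ₂ : Matrix (Fin 2) (Fin 2) E).trace - 2) * Valued.v (ϖ ^ (d % 2)) ≤ Valued.v (ϖ ^ mcOfRecord d))
    (hp : Valued.v ((γ₂ : Matrix (Fin 2) (Fin 2) E).det - (γ₂ : Matrix (Fin 2) (Fin 2) E).trace + 1) ≤ Valued.v (ϖ ^ mcOfRecord d))
    (j b : ℕ) (hb1 : 1 ≤ b) (_hbj : b < j) (_h2b : m < 2 * b) (hline : j + m = jl + b)
    (_hband1 : mstarOfRecord d + 2 * b ≤ 2 * m) (hband2 : 2 * m < mcOfRecord d + 2 * b) (hlamj : IsOrd ρ α (jE ϖ ^ j) lam) :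
    ((∑ᶠ Λ ∈ levelSetDep ρ Θ α (jE ϖ) h j b (lam - jE ((u : Matrix (Fin 1) (Fin 1) E) 0 0)) ∩
                      {Λ | ∃ B : Submodule 𝒪[E] (Fin 2 → E), B.toAddSubgroup.map φ = Λ ∧
                        ∃ L₃ : Submodule 𝒪[E] (Fin 3 → E), IsSelfDualLattice σ ϖ (!![H₂ 0 0, 0, H₂ 0 1; 0, hW, 0; H₂ 1 0, 0, H₂ 1 1] : Matrix (Fin 3) (Fin 3) E) L₃ ∧
                          L₃ ⊓ LinearMap.ker ((LinearMap.proj (1 : Fin 3) : (Fin 3 → E) →ₗ[E] E).restrictScalars 𝒪[E]) =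
                            B.map ((Matrix.toLin' (!![1, 0; 0, 0; 0, 1] : Matrix (Fin 3) (Fin 2) E)).restrictScalars 𝒪[E]) ∧
                          (∀ c : E, (Pi.single 1 c : Fin 3 → E) ∈ L₃ ↔ Valued.v c ≤ Valued.v ϖ ^ b) ∧
                          (LatticeNearTransvShell ϖ (d % 2) (mstarOfRecord d) ((((endoGL (γ₂, u) : GL (Fin 3) E) : Matrix (Fin 3) (Fin 3) E) - 1)) L₃ ∧
                            {z : E | ∃ y ∈ L₃, Valued.v ((ϖ ^ (mstarOfRecord d))⁻¹ * (z - pairing σ (!![H₂ 0 0, 0, H₂ 0 1; 0, hW, 0; H₂ 1 0, 0, H₂ 1 1] : Matrix (Fin 3) (Fin 3) E) y (((((endoGL (γ₂, u) : GL (Fin 3) E) : Matrix (Fin 3) (Fin 3) E) - 1)) *ᵥ y))) ≤ 1} =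
                              valueSetMod σ ϖ (mstarOfRecord d) (xPlus σ ϖ d))}, f b j Λ : ℕ) : ℤ) -
      ((∑ᶠ Λ ∈ levelSetDep ρ Θ α (jE ϖ) h j b (lam - jE ((u : Matrix (Fin 1) (Fin 1) E) 0 0)) ∩
                      {Λ | ∃ B : Submodule 𝒪[E] (Fin 2 → E), B.toAddSubgroup.map φ = Λ ∧
                        ∃ L₃ : Submodule 𝒪[E] (Fin 3 → E), IsSelfDualLattice σ ϖ (!![H₂ 0 0, 0, H₂ 0 1; 0, hW, 0; H₂ 1 0, 0, H₂ 1 1] : Matrix (Fin 3) (Fin 3) E) L₃ ∧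
                          L₃ ⊓ LinearMap.ker ((LinearMap.proj (1 : Fin 3) : (Fin 3 → E) →ₗ[E] E).restrictScalars 𝒪[E]) =
                            B.map ((Matrix.toLin' (!![1, 0; 0, 0; 0, 1] : Matrix (Fin 3) (Fin 2) E)).restrictScalars 𝒪[E]) ∧
                          (∀ c : E, (Pi.single 1 c : Fin 3 → E) ∈ L₃ ↔ Valued.v c ≤ Valued.v ϖ ^ b) ∧
                          (LatticeNearTransvShell ϖ (d % 2) (mcOfRecord d) ((((endoGL (γ₂, u) : GL (Fin 3) E) : Matrix (Fin 3) (Fin 3) E) - 1)) L₃ ∧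
                            ¬ {z : E | ∃ y ∈ L₃, Valued.v ((ϖ ^ (mstarOfRecord d))⁻¹ * (z - pairing σ (!![H₂ 0 0, 0, H₂ 0 1; 0, hW, 0; H₂ 1 0, 0, H₂ 1 1] : Matrix (Fin 3) (Fin 3) E) y (((((endoGL (γ₂, u) : GL (Fin 3) E) : Matrix (Fin 3) (Fin 3) E) - 1)) *ᵥ y))) ≤ 1} =
                              valueSetMod σ ϖ (mstarOfRecord d) (xPlus σ ϖ d))}, f b j Λ : ℕ) : ℤ) = 0 :=
  cellDiff_top_eq_zero σ hD hH₂ hH₂σ hhW jE hρρ hvρ hα hα1 hint hΘΘ hΘρ hvΘ hjv hjfix hjpow hϖmax hjiso hU φ hφs hφi hφo hφγ hlam hΘh hh hform u hum hm hjl f hmcm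
    P₁ hA hΓ hdet hu hs hp j b hb1 hline hband2 hlamj

end Summit.HodgeConjecture.HodgeConjecture.Cruxes.H413.F0P3cDyRamTopConeCellMid

end
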